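import Literature.Geometry.Manifold.CechSmoothSingular
import Literature.Algebra.Homology.DoubleComplexNaturality
import HarnessLib

/-!
# Morphisms of Čech–singular double complexes: restriction to smooth chains, change of coefficients

Two morphisms of doubly augmented anticommuting double complexes
(`Literature.Algebra.Homology.ADoubleComplex.Hom` / `RowAugmentation.Hom` of
`DoubleComplexNaturality`), for a family of subsets `𝔘` of a `C^∞` manifold `M`:

* **restriction to smooth chains** `cechToSmooth : C^p(𝔘, C^q) → C^p(𝔘, C^q_{sm})` (dual of the
  inclusions `Δ^{sm}(U_J) ≤ C(U_J)`, Bredon (1993), §V.9 "the natural map `Δ^* → Δ^*_{smooth}`"),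
  together with its companions on the row augmentation (`𝔘`-small cochains → smooth `𝔘`-small
  cochains, `cechToSmoothRow`) and on the column augmentation (`0`-cocycles → smooth `0`-cocycles,
  `cechToSmoothCol`);
* **change of coefficients** along an `R`-linear `f : N → N'` for the singular double complex
  (`cechCoeff`, `cechCoeffRow`, `cechCoeffCol`; the maps `coeffMap`, `scoeffMap` on cochains).

With `ADoubleComplex.rowColEquiv_natural` these make the Čech comparison isomorphisms
`cechSingularEquiv` / `cechSmoothSingularEquiv` natural in both senses (`cechSingularEquiv_natural_toSmooth`,
`cechSingularEquiv_natural_coeff`): the form in which an INTEGER Čech cocycle attached to an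
integral singular class is followed into the real smooth complex, where it meets the zigzag of a
differential form (the Čech integrality step of Lefschetz's theorem on `(1,1)`-classes; Weil 1952,
§3; Bott–Tu Thm. 15.8). No named facts; everything is proved.

## References

* G. E. Bredon, *Topology and Geometry*, GTM 139 (1993), §V.9, Thm. V.9.5. [Bredon1993]
* R. Bott, L. W. Tu, *Differential Forms in Algebraic Topology* (1982), §8, Thm. 15.8.
  [BottTu1982Forms]
-/

noncomputable section

-- as in `CechSingular`: chains of the concrete complex are `Finsupp`s up to unfolding
set_option backward.isDefEq.respectTransparency false

open scoped Manifold ContDiff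
open CategoryTheory Literature.Algebra.Homology Literature.AlgebraicTopology.SingularHomology

universe u v w w'

namespace Literature.Geometry.Manifold

variable {E : Type*} [NormedAddCommGroup E] [NormedSpace ℝ E]
  {H : Type*} [TopologicalSpace H] {I : ModelWithCorners ℝ E H}
  {R : Type v} [CommRing R] {M : Type u} [TopologicalSpace M] [ChartedSpace H M]
  {N : Type w} [AddCommGroup N] [Module R N] {N' : Type w'} [AddCommGroup N'] [Module R N']
  {ι : Type*}

/-! ### Restriction of cochains to smooth chains -/

variable (I) in
/-- **Restriction of a cochain of `A` to the smooth chains of `A`** (dual of `Δ^{sm}(A) ≤ C(A)`).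
[cite: Bredon1993, §V.9] -/
def toSCochain (A : Set M) (q : ℕ) : CochainOn R N A q →ₗ[R] SCochainOn I R N A q where
  toFun ψ := ψ ∘ₗ ((Subcomplex.incl (smoothChainsInSub_le_chainsInSub (I := I) (R := R) (A := R) A)).f q).hom
  map_add' _ _ := LinearMap.add_comp _ _ _
  map_smul' _ _ := LinearMap.smul_comp _ _ _

/-- Restriction to smooth chains is precomposition with the inclusion. [folklore] -/
theorem toSCochain_apply {A : Set M} {q : ℕ} (ψ : CochainOn R N A q)
    (c : (smoothChainsInSub I R R M A).toComplex.X q) :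
    toSCochain I A q ψ c =
      ψ (((Subcomplex.incl (smoothChainsInSub_le_chainsInSub (I := I) (R := R) (A := R) A)).f q).hom c) :=
  rfl

/-- Restriction to smooth chains commutes with the coboundaries. [folklore] -/
theorem toSCochain_cod {A : Set M} {q : ℕ} (ψ : CochainOn R N A q) :
    toSCochain I A (q + 1) (cod A q ψ) = scod A q (toSCochain I A q ψ) := by
  have hc := congrArg (ModuleCat.Hom.hom (R := R))
    ((Subcomplex.incl (smoothChainsInSub_le_chainsInSub (I := I) (R := R) (A := R) A)).comm (q + 1) q)
  rw [ModuleCat.hom_comp, ModuleCat.hom_comp] at hc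
  change (ψ ∘ₗ _) ∘ₗ _ = (ψ ∘ₗ _) ∘ₗ _
  rw [LinearMap.comp_assoc, hc, ← LinearMap.comp_assoc]

/-- Restriction to smooth chains commutes with the restrictions along `A ⊆ B`. [folklore] -/
theorem toSCochain_cres {A B : Set M} (h : A ⊆ B) {q : ℕ} (ψ : CochainOn R N B q) :
    toSCochain I A q (cres h q ψ) = scres h q (toSCochain I B q ψ) := by
  have h1 := congrArg (fun φ ↦ ModuleCat.Hom.hom (R := R) (HomologicalComplex.Hom.f φ q))
    (Subcomplex.incl_comp_incl (smoothChainsInSub_le_chainsInSub (I := I) (R := R) (A := R) A)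
      (chainsInSub_mono R R h))
  have h2 := congrArg (fun φ ↦ ModuleCat.Hom.hom (R := R) (HomologicalComplex.Hom.f φ q))
    (Subcomplex.incl_comp_incl (smoothChainsInSub_mono (I := I) (R := R) (A := R) (M := M) h)
      (smoothChainsInSub_le_chainsInSub (I := I) (R := R) (A := R) B))
  simp only [HomologicalComplex.comp_f, ModuleCat.hom_comp] at h1 h2
  change (ψ ∘ₗ _) ∘ₗ _ = (ψ ∘ₗ _) ∘ₗ _
  rw [LinearMap.comp_assoc, LinearMap.comp_assoc, h1, h2]

/-- Restriction to smooth chains does not change the values on smooth simplices. [folklore] -/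
theorem sEvalSimplex_toSCochain {A : Set M} {q : ℕ} (ψ : CochainOn R N A q) {σ : SingularSimplex M q}
    (hσ : IsSmoothIn I A σ) : sEvalSimplex (toSCochain I A q ψ) σ = evalSimplex ψ σ := by
  rw [sEvalSimplex_of_isSmoothIn _ hσ, evalSimplex_of_subset _ hσ.2]
  rfl

section Cech

variable (U : ι → Set M)

/-! ### Restriction to smooth chains as a morphism of doubly augmented double complexes -/

variable (I R N) in
/-- **Restriction to smooth chains on the Čech–singular double complex**,
`C^p(𝔘, C^q) → C^p(𝔘, C^q_{sm})`. [cite: Bredon1993, §V.9] -/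
def cechToSmooth : (cechSingular R N U).Hom (cechSmoothSingular I R N U) where
  f p q :=
    { toFun := fun c J ↦ toSCochain I (cechSet U J) q (c J)
      map_add' := fun c c' ↦ by
        funext J; exact map_add (toSCochain I (cechSet U J) q) (c J) (c' J)
      map_smul' := fun r c ↦ by
        funext J; exact map_smul (toSCochain I (cechSet U J) q) r (c J) }
  f_d p q c := by
    funext J
    change toSCochain I (cechSet U J) (q + 1) ((-1 : R) ^ p • cod (cechSet U J) q (c J)) =
      (-1 : R) ^ p • scod (cechSet U J) q (toSCochain I (cechSet U J) q (c J))
    rw [map_smul, toSCochain_cod]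
  f_δ p q c := by
    funext J
    change toSCochain I (cechSet U J) q (cechδ R N U p q c J) =
      cechSδ I R N U p q (fun J ↦ toSCochain I (cechSet U J) q (c J)) J
    rw [cechδ_apply, cechSδ_apply, map_sum]
    refine Finset.sum_congr rfl fun j _ ↦ ?_
    rw [map_smul, toSCochain_cres]

/-- The components of `cechToSmooth`, componentwise. [folklore] -/
theorem cechToSmooth_f_apply {p q : ℕ} (c : CechCochain R N U p q) (J : Fin (p + 1) → ι) :
    (cechToSmooth I R N U).f p q c J = toSCochain I (cechSet U J) q (c J) :=
  rfl

/-- `Δ^{sm,𝔘} ≤ C^𝔘`. [folklore] -/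
theorem smoothSmallSub_le_smallSub : smoothSmallSub I R U ≤ smallSub R R M U :=
  inf_le_right

variable (I R N) in
/-- **Restriction to smooth small chains** `Hom(C^𝔘, N) → Hom(Δ^{sm,𝔘}, N)`. [cite: Bredon1993, §V.9] -/
def smallToSmoothSmall (q : ℕ) : SmallCochain R N U q →ₗ[R] SmoothSmallCochain I R N U q where
  toFun a := a ∘ₗ ((Subcomplex.incl (smoothSmallSub_le_smallSub (I := I) (R := R) U)).f q).hom
  map_add' _ _ := LinearMap.add_comp _ _ _
  map_smul' _ _ := LinearMap.smul_comp _ _ _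

variable (I R N) in
/-- **`cechToSmooth` on the row augmentations**: restriction of `𝔘`-small cochains to smooth
`𝔘`-small chains. [cite: Bredon1993, §V.9] -/
def cechToSmoothRow :
    ADoubleComplex.RowAugmentation.Hom (cechSingularRow R N U) (cechSmoothSingularRow I R N U)
      (cechToSmooth I R N U) where
  g q := smallToSmoothSmall I R N U q
  g_dA q a := by
    change (a ∘ₗ ((smallSub R R M U).toComplex.d (q + 1) q).hom) ∘ₗ
        ((Subcomplex.incl (smoothSmallSub_le_smallSub (I := I) (R := R) U)).f (q + 1)).hom =
      (a ∘ₗ ((Subcomplex.incl (smoothSmallSub_le_smallSub (I := I) (R := R) U)).f q).hom) ∘ₗ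
        ((smoothSmallSub I R U).toComplex.d (q + 1) q).hom
    have hc := congrArg (ModuleCat.Hom.hom (R := R))
      ((Subcomplex.incl (smoothSmallSub_le_smallSub (I := I) (R := R) U)).comm (q + 1) q)
    rw [ModuleCat.hom_comp, ModuleCat.hom_comp] at hc
    rw [LinearMap.comp_assoc, hc, ← LinearMap.comp_assoc]
  ε_g q a := by
    funext J
    change (a ∘ₗ ((Subcomplex.incl (smoothSmallSub_le_smallSub (I := I) (R := R) U)).f q).hom) ∘ₗ
        ((Subcomplex.incl (smoothChainsInSub_cechSet_le_smoothSmallSub (I := I) (R := R) U J)).f q).hom =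
      (a ∘ₗ ((Subcomplex.incl (chainsInSub_cechSet_le_smallSub (R := R) U J)).f q).hom) ∘ₗ
        ((Subcomplex.incl (smoothChainsInSub_le_chainsInSub (I := I) (R := R) (A := R) (cechSet U J))).f q).hom
    have h1 := congrArg (fun φ ↦ ModuleCat.Hom.hom (R := R) (HomologicalComplex.Hom.f φ q))
      (Subcomplex.incl_comp_incl (smoothChainsInSub_cechSet_le_smoothSmallSub (I := I) (R := R) U J)
        (smoothSmallSub_le_smallSub (I := I) (R := R) U))
    have h2 := congrArg (fun φ ↦ ModuleCat.Hom.hom (R := R) (HomologicalComplex.Hom.f φ q))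
      (Subcomplex.incl_comp_incl (smoothChainsInSub_le_chainsInSub (I := I) (R := R) (A := R) (cechSet U J))
        (chainsInSub_cechSet_le_smallSub (R := R) U J))
    simp only [HomologicalComplex.comp_f, ModuleCat.hom_comp] at h1 h2
    rw [LinearMap.comp_assoc, LinearMap.comp_assoc, h1, h2]

/-- Restriction to smooth chains preserves `0`-cocycles. [folklore] -/
theorem toSCochain_mem_zeroSCocycles {A : Set M} {ψ : CochainOn R N A 0}
    (hψ : ψ ∈ zeroCocycles R N A) : toSCochain I A 0 ψ ∈ zeroSCocycles I R N A := by
  rw [LinearMap.mem_ker] at hψ ⊢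
  rw [← toSCochain_cod, hψ, map_zero]

variable (I R N) in
/-- **`cechToSmooth` on the column augmentations**: `0`-cocycles restrict to smooth `0`-cocycles.
[cite: Bredon1993, §V.9] -/
def cechToSmoothCol :
    ADoubleComplex.RowAugmentation.Hom (cechSingularCol R N U) (cechSmoothSingularCol I R N U)
      (cechToSmooth I R N U).swap where
  g p :=
    { toFun := fun b J ↦ ⟨toSCochain I (cechSet U J) 0 (b J), toSCochain_mem_zeroSCocycles (b J).2⟩
      map_add' := fun _ _ ↦ by funext J; exact Subtype.ext (map_add _ _ _)
      map_smul' := fun _ _ ↦ by funext J; exact Subtype.ext (map_smul _ _ _) }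
  g_dA p b := by
    funext J
    apply Subtype.ext
    change toSCochain I (cechSet U J) 0 (cechZeroδ R N U p b J : CochainOn R N (cechSet U J) 0) =
      (cechZeroSδ I R N U p (fun J ↦ ⟨toSCochain I (cechSet U J) 0 (b J),
        toSCochain_mem_zeroSCocycles (b J).2⟩) J : SCochainOn I R N (cechSet U J) 0)
    rw [coe_cechZeroδ_apply, coe_cechZeroSδ_apply, map_sum]
    refine Finset.sum_congr rfl fun j _ ↦ ?_
    rw [map_smul, toSCochain_cres]
  ε_g p b := by
    funext J
    rfl

/-! ### Change of coefficients -/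

/-- **Change of coefficients** `N → N'` on the cochains of a subset (post-composition).
[cite: HatcherAT2002, §3.1 p. 198] -/
def coeffMap (f : N →ₗ[R] N') (A : Set M) (q : ℕ) : CochainOn R N A q →ₗ[R] CochainOn R N' A q where
  toFun ψ := f ∘ₗ ψ
  map_add' _ _ := LinearMap.comp_add _ _ _
  map_smul' _ _ := LinearMap.comp_smul _ _ _

/-- **Change of coefficients** on the smooth cochains of a subset. [cite: HatcherAT2002, §3.1 p. 198] -/
def scoeffMap (f : N →ₗ[R] N') (A : Set M) (q : ℕ) : SCochainOn I R N A q →ₗ[R] SCochainOn I R N' A q where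
  toFun ψ := f ∘ₗ ψ
  map_add' _ _ := LinearMap.comp_add _ _ _
  map_smul' _ _ := LinearMap.comp_smul _ _ _

/-- The values change along `f`. [folklore] -/
theorem evalSimplex_coeffMap (f : N →ₗ[R] N') {A : Set M} {q : ℕ} (ψ : CochainOn R N A q)
    (σ : SingularSimplex M q) : evalSimplex (coeffMap f A q ψ) σ = f (evalSimplex ψ σ) := by
  by_cases h : σ.range ⊆ A
  · rw [evalSimplex_of_subset _ h, evalSimplex_of_subset _ h]
    rfl
  · simp only [evalSimplex, dif_neg h, map_zero]

/-- The values change along `f` (smooth cochains). [folklore] -/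
theorem sEvalSimplex_scoeffMap (f : N →ₗ[R] N') {A : Set M} {q : ℕ} (ψ : SCochainOn I R N A q)
    (σ : SingularSimplex M q) : sEvalSimplex (scoeffMap (I := I) f A q ψ) σ = f (sEvalSimplex ψ σ) := by
  by_cases h : IsSmoothIn I A σ
  · rw [sEvalSimplex_of_isSmoothIn _ h, sEvalSimplex_of_isSmoothIn _ h]
    rfl
  · simp only [sEvalSimplex, dif_neg h, map_zero]

variable (R) in
/-- **Change of coefficients on the Čech–singular double complex.** [cite: HatcherAT2002, §3.1 p. 198] -/
def cechCoeff (f : N →ₗ[R] N') : (cechSingular R N U).Hom (cechSingular R N' U) where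
  f p q :=
    { toFun := fun c J ↦ coeffMap f (cechSet U J) q (c J)
      map_add' := fun c c' ↦ by
        funext J; exact map_add (coeffMap f (cechSet U J) q) (c J) (c' J)
      map_smul' := fun r c ↦ by
        funext J; exact map_smul (coeffMap f (cechSet U J) q) r (c J) }
  f_d p q c := by
    funext J
    change f ∘ₗ ((-1 : R) ^ p • cod (cechSet U J) q (c J)) = (-1 : R) ^ p • ((f ∘ₗ c J) ∘ₗ _)
    rw [LinearMap.comp_smul, LinearMap.comp_assoc]
    rfl
  f_δ p q c := by
    funext J
    change f ∘ₗ cechδ R N U p q c J = cechδ R N' U p q (fun J ↦ f ∘ₗ c J) J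
    have hs := map_sum (LinearMap.llcomp R ((chainsInSub R R M (cechSet U J)).toComplex.X q) N N' f)
      (fun j : Fin (p + 2) ↦ (-1 : R) ^ (j : ℕ) •
        cres (cechSet_subset_comp U J (Fin.succAbove j)) q (c (J ∘ Fin.succAbove j))) Finset.univ
    simp only [LinearMap.llcomp_apply'] at hs
    rw [cechδ_apply, cechδ_apply, hs]
    refine Finset.sum_congr rfl fun j _ ↦ ?_
    rw [LinearMap.comp_smul]
    rfl

variable (R) in
/-- Change of coefficients on the row augmentation (small cochains). [cite: HatcherAT2002, §3.1 p. 198] -/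
def cechCoeffRow (f : N →ₗ[R] N') :
    ADoubleComplex.RowAugmentation.Hom (cechSingularRow R N U) (cechSingularRow R N' U) (cechCoeff R U f) where
  g q :=
    { toFun := fun a ↦ f ∘ₗ a
      map_add' := fun _ _ ↦ LinearMap.comp_add _ _ _
      map_smul' := fun _ _ ↦ LinearMap.comp_smul _ _ _ }
  g_dA q a := by
    change f ∘ₗ (a ∘ₗ _) = (f ∘ₗ a) ∘ₗ _
    rw [LinearMap.comp_assoc]
  ε_g q a := by
    funext J
    change (f ∘ₗ a) ∘ₗ _ = f ∘ₗ (a ∘ₗ _)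
    rw [LinearMap.comp_assoc]

/-- Change of coefficients preserves `0`-cocycles. [folklore] -/
theorem coeffMap_mem_zeroCocycles (f : N →ₗ[R] N') {A : Set M} {ψ : CochainOn R N A 0}
    (hψ : ψ ∈ zeroCocycles R N A) : coeffMap f A 0 ψ ∈ zeroCocycles R N' A := by
  rw [LinearMap.mem_ker] at hψ ⊢
  change (f ∘ₗ ψ) ∘ₗ _ = 0
  rw [LinearMap.comp_assoc]
  change f ∘ₗ cod A 0 ψ = 0
  rw [hψ, LinearMap.comp_zero]

variable (R) in
/-- Change of coefficients on the column augmentation (`0`-cocycles). [cite: HatcherAT2002, §3.1 p. 198] -/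
def cechCoeffCol (f : N →ₗ[R] N') :
    ADoubleComplex.RowAugmentation.Hom (cechSingularCol R N U) (cechSingularCol R N' U) (cechCoeff R U f).swap where
  g p :=
    { toFun := fun b J ↦ ⟨coeffMap f (cechSet U J) 0 (b J), coeffMap_mem_zeroCocycles f (b J).2⟩
      map_add' := fun _ _ ↦ by funext J; exact Subtype.ext (map_add _ _ _)
      map_smul' := fun _ _ ↦ by funext J; exact Subtype.ext (map_smul _ _ _) }
  g_dA p b := by
    funext J
    apply Subtype.ext
    change f ∘ₗ (cechZeroδ R N U p b J : CochainOn R N (cechSet U J) 0) =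
      (cechZeroδ R N' U p (fun J ↦ ⟨coeffMap f (cechSet U J) 0 (b J),
        coeffMap_mem_zeroCocycles f (b J).2⟩) J : CochainOn R N' (cechSet U J) 0)
    have hs := map_sum (LinearMap.llcomp R ((chainsInSub R R M (cechSet U J)).toComplex.X 0) N N' f)
      (fun j : Fin (p + 2) ↦ (-1 : R) ^ (j : ℕ) •
        cres (cechSet_subset_comp U J (Fin.succAbove j)) 0
          (b (J ∘ Fin.succAbove j) : CochainOn R N (cechSet U (J ∘ Fin.succAbove j)) 0)) Finset.univ
    simp only [LinearMap.llcomp_apply'] at hs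
    rw [coe_cechZeroδ_apply, coe_cechZeroδ_apply, hs]
    refine Finset.sum_congr rfl fun j _ ↦ ?_
    rw [LinearMap.comp_smul]
    rfl
  ε_g p b := by
    funext J
    rfl

/-! ### Naturality of the Čech comparison isomorphisms -/

/-- **The Čech–singular comparison is natural for the restriction to smooth chains**: for a family
all of whose finite intersections are acyclic both for singular and for smooth singular cochains,
`cechSmoothSingularEquiv (res c) = (res on Čech 0-cocycles) (cechSingularEquiv c)`.
[cite: BottTu1982Forms, Thm. 15.8] [cite: Bredon1993, Thm. V.9.5] -/
theorem cechSingularEquiv_natural_toSmooth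
    (hacyc : ∀ (p q : ℕ) (J : Fin (p + 1) → ι) (ψ : CochainOn R N (cechSet U J) (q + 1)),
      cod (cechSet U J) (q + 1) ψ = 0 → ∃ φ : CochainOn R N (cechSet U J) q, cod (cechSet U J) q φ = ψ)
    (hacycS : ∀ (p q : ℕ) (J : Fin (p + 1) → ι) (ψ : SCochainOn I R N (cechSet U J) (q + 1)),
      scod (cechSet U J) (q + 1) ψ = 0 → ∃ φ : SCochainOn I R N (cechSet U J) q, scod (cechSet U J) q φ = ψ)
    (n : ℕ) (c : NatCochain.Cohomology (cechSingularRow R N U).dA n) :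
    cechSmoothSingularEquiv U hacycS n ((cechToSmoothRow I R N U).cohMap n c) =
      (cechToSmoothCol I R N U).cohMap n (cechSingularEquiv U hacyc n c) :=
  ADoubleComplex.rowColEquiv_natural (cechToSmooth I R N U) (cechToSmoothRow I R N U)
    (cechToSmoothCol I R N U) (cechSingular_rowExact U) (cechSingularRow_exact U)
    (cechSingular_colExact U hacyc) (cechSingularCol_exact U) (cechSmoothSingular_rowExact U)
    (cechSmoothSingularRow_exact U) (cechSmoothSingular_colExact U hacycS) (cechSmoothSingularCol_exact U) n c

/-- **The Čech–singular comparison is natural for a change of coefficients** `f : N → N'`.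
[cite: BottTu1982Forms, Thm. 15.8] [cite: HatcherAT2002, §3.1 p. 198] -/
theorem cechSingularEquiv_natural_coeff (f : N →ₗ[R] N')
    (hacyc : ∀ (p q : ℕ) (J : Fin (p + 1) → ι) (ψ : CochainOn R N (cechSet U J) (q + 1)),
      cod (cechSet U J) (q + 1) ψ = 0 → ∃ φ : CochainOn R N (cechSet U J) q, cod (cechSet U J) q φ = ψ)
    (hacyc' : ∀ (p q : ℕ) (J : Fin (p + 1) → ι) (ψ : CochainOn R N' (cechSet U J) (q + 1)),
      cod (cechSet U J) (q + 1) ψ = 0 → ∃ φ : CochainOn R N' (cechSet U J) q, cod (cechSet U J) q φ = ψ)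
    (n : ℕ) (c : NatCochain.Cohomology (cechSingularRow R N U).dA n) :
    cechSingularEquiv U hacyc' n ((cechCoeffRow R U f).cohMap n c) =
      (cechCoeffCol R U f).cohMap n (cechSingularEquiv U hacyc n c) :=
  ADoubleComplex.rowColEquiv_natural (cechCoeff R U f) (cechCoeffRow R U f) (cechCoeffCol R U f)
    (cechSingular_rowExact U) (cechSingularRow_exact U) (cechSingular_colExact U hacyc)
    (cechSingularCol_exact U) (cechSingular_rowExact U) (cechSingularRow_exact U)
    (cechSingular_colExact U hacyc') (cechSingularCol_exact U) n c

end Cech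

end Literature.Geometry.Manifold

end
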